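import Mathlib
import HarnessLib
import Literature.MathematicalPhysics.QuantumLattice.FrameComplementCertificate

/-!
# Frame complement certificates — sigma-indexed block bookkeeping

Companion to `FrameComplementCertificate.lean` (`form_ge_on_ker_of_blocks`): when the frame columns are
ORDERED BY BLOCK, i.e. the index type is a sigma type `(b : B) × T b` (block label `b`, in-block index
`i : T b` — in the ED application `b` = a symmetry sector of the lattice automorphism × spin-flip group and
`T b = F_b ⊕ P_b` = its free / pinned orbit sums), the block-wise hypothesis of `form_ge_on_ker_of_blocks`
becomes a statement about the honest `T b × T b` corner matrices `M_b = (M ⟨b,i⟩ ⟨b,i'⟩)_{i,i'}`,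
`G_b`, and the restricted constraint vectors `c_{j,b} = (c_j ⟨b,i⟩)_i` — exactly the per-block objects an
exact block certificate (one `fromBlocks` inertia / Schur certificate per block, e.g.
`Literature.Analysis.OperatorTheory.fromBlocks_dotProduct_nonneg_of_schur_poly_cert` composed with
`form_ge_on_ker_of_rank_modified_fromBlocks`) is about. Pure bookkeeping (Haynsworth inertia additivity
over a direct sum); no analysis.
* `dotProduct_eq_fiber`, `dotProduct_mulVec_eq_fiber` — a vector supported on the fiber over `b` pairs /
  sandwiches through the `b`-corner only.
* `form_ge_on_ker_of_sigma_blocks` — block-diagonal `M`, `G`, block-local constraints, and for every block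
  `b`: `β G_b ≤ M_b` (as forms) on `{w : c_{j,b} ⬝ w = 0 ∀ j}` ⟹ `β G ≤ M` on `{y : c_j ⬝ y = 0 ∀ j}`.
* `frame_form_ge_of_support_bound` — a "corner" form bound `c₀‖ψ‖² ≤ Re⟨ψ, Aψ⟩` valid for all `ψ`
  vanishing off a coordinate set `S` transfers to the real compressions `M = Φᴴ A Φ`, `G = Φᴴ Φ` of any
  frame whose columns are supported in `S`: `c₀ (z ⬝ G z) ≤ z ⬝ M z` for all real `z` (the hypothesis
  `(A_F − c•G_F).PosSemidef` of the free block of a Schur certificate, via `posSemidef_sub_smul_of_form_ge`).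
* `isHermitian_of_real_frame_compression` — a real compression of a Hermitian matrix is symmetric.
-/

namespace Literature.MathematicalPhysics.QuantumLattice.TempleKato

open Matrix

variable {B : Type*} [Fintype B] {T : B → Type*} [∀ b, Fintype (T b)]

/-- A vector supported on the fiber over `b` pairs only through that fiber:
`u ⬝ z = Σ_i u⟨b,i⟩ z⟨b,i⟩`. (Haynsworth inertia additivity over a direct sum, bookkeeping.)
[cite: Haynsworth1968, Thm 1] -/
theorem dotProduct_eq_fiber (b : B) (u z : ((b : B) × T b) → ℝ) (hz : ∀ a, a.1 ≠ b → z a = 0) :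
    u ⬝ᵥ z = (fun i => u ⟨b, i⟩) ⬝ᵥ (fun i => z ⟨b, i⟩) := by
  simp only [dotProduct]
  rw [← Finset.univ_sigma_univ, Finset.sum_sigma]
  rw [Finset.sum_eq_single b (fun b' _ hb' => ?_) (fun h => absurd (Finset.mem_univ b) h)]
  exact Finset.sum_eq_zero fun i _ => by rw [hz ⟨b', i⟩ hb', mul_zero]

/-- A vector supported on the fiber over `b` sandwiches any matrix through its `b`-corner:
`z ⬝ N z = w ⬝ N_b w`, `w_i = z⟨b,i⟩`, `N_b = (N ⟨b,i⟩ ⟨b,i'⟩)`. [cite: Haynsworth1968, Thm 1] -/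
theorem dotProduct_mulVec_eq_fiber (b : B) (N : Matrix ((b : B) × T b) ((b : B) × T b) ℝ)
    (z : ((b : B) × T b) → ℝ) (hz : ∀ a, a.1 ≠ b → z a = 0) :
    z ⬝ᵥ N *ᵥ z =
      (fun i => z ⟨b, i⟩) ⬝ᵥ (Matrix.of fun i i' => N ⟨b, i⟩ ⟨b, i'⟩) *ᵥ (fun i => z ⟨b, i⟩) := by
  rw [dotProduct_comm, dotProduct_eq_fiber b (N *ᵥ z) z hz, dotProduct_comm]
  refine congrArg _ (funext fun i => ?_)
  rw [mulVec, mulVec, dotProduct_eq_fiber b _ z hz]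
  rfl

/-- **Block bookkeeping on a sigma-indexed frame.** If `M`, `G` are block diagonal for the block label
`Sigma.fst`, every constraint vector `c_j` lives in one block, and on every block `b` the corner forms
satisfy `β (w ⬝ G_b w) ≤ w ⬝ M_b w` whenever `c_{j,b} ⬝ w = 0` for all `j`, then
`β (y ⬝ G y) ≤ y ⬝ M y` whenever `c_j ⬝ y = 0` for all `j`. [cite: Haynsworth1968, Thm 1] -/
theorem form_ge_on_ker_of_sigma_blocks [DecidableEq B] (M G : Matrix ((b : B) × T b) ((b : B) × T b) ℝ)
    (β : ℝ)
    {k : ℕ} (c : Fin k → ((b : B) × T b) → ℝ)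
    (hM : ∀ a a', a.1 ≠ a'.1 → M a a' = 0) (hG : ∀ a a', a.1 ≠ a'.1 → G a a' = 0)
    (hc : ∀ j, ∃ b, ∀ a, a.1 ≠ b → c j a = 0)
    (hblk : ∀ (b : B) (w : T b → ℝ), (∀ j, (fun i => c j ⟨b, i⟩) ⬝ᵥ w = 0) →
      β * (w ⬝ᵥ (Matrix.of fun i i' => G ⟨b, i⟩ ⟨b, i'⟩) *ᵥ w) ≤
        w ⬝ᵥ (Matrix.of fun i i' => M ⟨b, i⟩ ⟨b, i'⟩) *ᵥ w)
    (y : ((b : B) × T b) → ℝ) (hy : ∀ j, c j ⬝ᵥ y = 0) :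
    β * (y ⬝ᵥ G *ᵥ y) ≤ y ⬝ᵥ M *ᵥ y := by
  refine form_ge_on_ker_of_blocks Sigma.fst M G β c hM hG hc (fun b z hzb hzc => ?_) y hy
  rw [dotProduct_mulVec_eq_fiber b G z hzb, dotProduct_mulVec_eq_fiber b M z hzb]
  refine hblk b (fun i => z ⟨b, i⟩) fun j => ?_
  rw [← dotProduct_eq_fiber b (c j) z hzb]
  exact hzc j

/-- **Sigma blocks with a free/pinned split.** Same, with `T b = F b ⊕ P b` and the corner hypothesis
phrased on `Sum.elim x y` (the shape produced by `fromBlocks` certificates). [cite: Haynsworth1968, Thm 1] -/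
theorem form_ge_on_ker_of_sigma_sum_blocks [DecidableEq B] {F P : B → Type*} [∀ b, Fintype (F b)]
    [∀ b, Fintype (P b)]
    (M G : Matrix ((b : B) × (F b ⊕ P b)) ((b : B) × (F b ⊕ P b)) ℝ) (β : ℝ)
    {k : ℕ} (c : Fin k → ((b : B) × (F b ⊕ P b)) → ℝ)
    (hM : ∀ a a', a.1 ≠ a'.1 → M a a' = 0) (hG : ∀ a a', a.1 ≠ a'.1 → G a a' = 0)
    (hc : ∀ j, ∃ b, ∀ a, a.1 ≠ b → c j a = 0)
    (hblk : ∀ (b : B) (x : F b → ℝ) (y : P b → ℝ),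
      (∀ j, (fun i => c j ⟨b, i⟩) ⬝ᵥ Sum.elim x y = 0) →
      β * (Sum.elim x y ⬝ᵥ (Matrix.of fun i i' => G ⟨b, i⟩ ⟨b, i'⟩) *ᵥ Sum.elim x y) ≤
        Sum.elim x y ⬝ᵥ (Matrix.of fun i i' => M ⟨b, i⟩ ⟨b, i'⟩) *ᵥ Sum.elim x y)
    (y : ((b : B) × (F b ⊕ P b)) → ℝ) (hy : ∀ j, c j ⬝ᵥ y = 0) :
    β * (y ⬝ᵥ G *ᵥ y) ≤ y ⬝ᵥ M *ᵥ y := by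
  refine form_ge_on_ker_of_sigma_blocks M G β c hM hG hc (fun b w hw => ?_) y hy
  have h := hblk b (w ∘ Sum.inl) (w ∘ Sum.inr)
  rw [Sum.elim_comp_inl_inr] at h
  exact h hw


/-! ### Corner bounds through a supported frame; symmetric packaging -/

section Corner

variable {ι μ : Type*} [Fintype ι] [Fintype μ]

omit [Fintype μ] in
/-- A real matrix whose complexification is a frame compression `Φᴴ A Φ` of a Hermitian `A` is symmetric.
[cite: HornJohnson2013, Thm 4.1.10] -/
theorem isHermitian_of_real_frame_compression (A : Matrix ι ι ℂ) (hA : A.IsHermitian) (Φ : Matrix ι μ ℂ)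
    (M : Matrix μ μ ℝ) (hM : Φᴴ * A * Φ = M.map ((↑) : ℝ → ℂ)) : M.IsHermitian := by
  have h : (M.map ((↑) : ℝ → ℂ))ᴴ = M.map ((↑) : ℝ → ℂ) := by
    rw [← hM, conjTranspose_mul, conjTranspose_mul, conjTranspose_conjTranspose, hA.eq,
      Matrix.mul_assoc]
  ext i j
  have hij := congrFun (congrFun h i) j
  simp only [conjTranspose_apply, map_apply, Complex.star_def, Complex.conj_ofReal,
    Complex.ofReal_inj] at hij
  simpa using hij

omit [Fintype μ] in
/-- The real Gram matrix of a frame is symmetric. [cite: HornJohnson2013, Thm 4.1.10] -/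
theorem isHermitian_of_real_frame_gram (Φ : Matrix ι μ ℂ) (G : Matrix μ μ ℝ)
    (hG : Φᴴ * Φ = G.map ((↑) : ℝ → ℂ)) : G.IsHermitian := by
  have h : (G.map ((↑) : ℝ → ℂ))ᴴ = G.map ((↑) : ℝ → ℂ) := by
    rw [← hG, conjTranspose_mul, conjTranspose_conjTranspose]
  ext i j
  have hij := congrFun (congrFun h i) j
  simp only [conjTranspose_apply, map_apply, Complex.star_def, Complex.conj_ofReal,
    Complex.ofReal_inj] at hij
  simpa using hij

/-- **Corner bound through a supported real frame.** If `c₀ ‖ψ‖² ≤ Re⟨ψ, A ψ⟩` for every `ψ`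
vanishing off the coordinate set `S`, and the columns of the frame `Φ` are supported in `S` with real
compressions `Φᴴ A Φ = M`, `Φᴴ Φ = G`, then `c₀ (z ⬝ G z) ≤ z ⬝ M z` for every real `z`.
[cite: HornJohnson2013, Thm 4.1.10] -/
theorem frame_form_ge_of_support_bound (A : Matrix ι ι ℂ) (S : ι → Prop) (c₀ : ℝ)
    (hcorner : ∀ ψ : ι → ℂ, (∀ s, ¬ S s → ψ s = 0) →
      c₀ * (star ψ ⬝ᵥ ψ).re ≤ (star ψ ⬝ᵥ A *ᵥ ψ).re)
    (Φ : Matrix ι μ ℂ) (hsupp : ∀ s a, ¬ S s → Φ s a = 0) (M G : Matrix μ μ ℝ)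
    (hM : Φᴴ * A * Φ = M.map ((↑) : ℝ → ℂ)) (hG : Φᴴ * Φ = G.map ((↑) : ℝ → ℂ)) (z : μ → ℝ) :
    c₀ * (z ⬝ᵥ G *ᵥ z) ≤ z ⬝ᵥ M *ᵥ z := by
  set y : μ → ℂ := fun a => (z a : ℂ) with hy
  have hψ : ∀ s, ¬ S s → (Φ *ᵥ y) s = 0 := fun s hs => by
    simp only [mulVec, dotProduct]
    exact Finset.sum_eq_zero fun a _ => by rw [hsupp s a hs, zero_mul]
  have h := hcorner (Φ *ᵥ y) hψ
  have hre : (fun a => (y a).re) = z := funext fun a => Complex.ofReal_re _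
  have him : (fun a => (y a).im) = 0 := funext fun a => Complex.ofReal_im _
  rw [frame_form, frame_norm, hM, hG, re_star_dotProduct_map_mulVec, re_star_dotProduct_map_mulVec,
    hre, him] at h
  simpa only [zero_dotProduct, add_zero] using h

/-- Packaging a real form inequality `c₀ (z ⬝ G z) ≤ z ⬝ A z` (all `z`) with `A`, `G` symmetric as
`(A − c₀ • G).PosSemidef` (the shape of the free-block hypothesis of a Schur certificate).
[cite: HornJohnson2013, Thm 4.1.10] -/
theorem posSemidef_sub_smul_of_form_ge (A G : Matrix μ μ ℝ) (hA : A.IsHermitian) (hG : G.IsHermitian)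
    (c₀ : ℝ) (h : ∀ z : μ → ℝ, c₀ * (z ⬝ᵥ G *ᵥ z) ≤ z ⬝ᵥ A *ᵥ z) : (A - c₀ • G).PosSemidef := by
  refine Matrix.PosSemidef.of_dotProduct_mulVec_nonneg ?_ fun x => ?_
  · unfold Matrix.IsHermitian
    rw [conjTranspose_sub, conjTranspose_smul, star_trivial, hA.eq, hG.eq]
  · have hx := h x
    rw [star_trivial, sub_mulVec, dotProduct_sub, smul_mulVec, dotProduct_smul, smul_eq_mul]
    linarith

end Corner

end Literature.MathematicalPhysics.QuantumLattice.TempleKato
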